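import Summits.QuantumFields.YangMills.Theorems.BalabanUVNodesN19SizeByName

/-!
# BalabanUVNodes ∕ N19 size-by-name — GUARD: the displayed identification binders of `N19SizeByName.sizePair_of_n11_n14`
# are JOINTLY SATISFIABLE, non-degenerately, and the face fires (seat dag-n19-a gen 3; count-neutral)

HONEST FRAMING.  A decided TOY, no physics: nothing of Bałaban's is modelled.  It shows that the hypothesis list of
`sizePair_of_n11_n14` — [III] Thm 2 (2.43) AS PRINTED for a family, node N14's pinned pair, and the three identification
binders (v-A), (v-B), (d) — is inhabited by data with a NONZERO two-run discrepancy on BOTH the vacuum and the dressed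
sub-ledger, so the face is not vacuous (referee checks A2 ∕ D2).  NE7 ∕ NE1′ NOT printed, NOT proved; N19 NOT discharged.
THEOREMS ONLY; 0 sorry; standard axioms.

THE TOY.  Printed family `toyFam L β : ℕ → B14.Sect2Data`: member `k` has `K = k`, couplings `g ≡ 1` with `β`-functions `≡ 0`
(solves (0.20)), one datum, printed volumes `|Γ_n ∩ Ω| = [n = k]` (the all-regular profile: only the top level), E-terms
`eTerm j k′ = [k′ = k]·(L^{−β})^{k−j}` (= the right side of (2.43) with `E₁ = 1`), R-terms `0`; so `B14.Thm2Printed` holds with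
`E₁ = 1`, `R₁ = 0` (`thm2Printed_toyFam`).  Dressed tower = the NE1′ owner's `toyTower` (positive sizes; N14's pinned pair
`YMDAG.N14.n14_toyTower_pinned`, count rate `2`, multiplicity `1`).  Ledger at cutoff `K`: two domains of scale `0`, the vacuum
one read by run A as `(L^{−β})^K` (dominated by member `K+1`'s E-term at level `j+1`, offset `K₁ = 1`), the dressed one as the
toy's own booked size; run B reads `0` — a NONZERO discrepancy on both parts.
-/

noncomputable section

open Finset
open scoped BigOperators

namespace Summit.QuantumFields.YangMills.BalabanUVNodes.N19SizeByName

open Literature.MathematicalPhysics.QuantumFieldTheory.Balaban1983to89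
open T4GoodClassBudget
open Summit.QuantumFields.BalabanUV.T4Continuum.NE1p.DressedRoot (toyTower toyBooking toy_size_pos)

/-- [decided toy] The toy printed family: member `k` = a `k`-step run with `g ≡ 1`, `β ≡ 0`, one datum, volumes `[n = k]`,
E-terms `[k′ = k]·(L^{−β})^{k−j}`, R-terms `0`.  No physics. [folklore] -/
theorem thm2Printed_toyFam {Lb β : ℝ} (hLb : 1 < Lb) :
    B14.Thm2Printed (fun _ _ => True)
      (fun k : ℕ => ({ K := k, flow := ⟨fun _ => 1, fun _ _ => 0⟩, InductiveAssumption := fun _ => True, Ω := Unit,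
                       eTerm := fun j k' _ => if k' = k then (Lb ^ (-β)) ^ (k - j) else 0,
                       rTerm := fun _ _ _ => 0,
                       gammaVol := fun n _ => if n = k then 1 else 0 } : B14.Sect2Data)) Lb β 0 := by
  intro _
  have hL0 : 0 < Lb := one_pos.trans hLb
  refine ⟨1, 0, fun k _ _ => ⟨fun j k' _ hj1 hjk hkK => ?_, fun j k' _ _ _ _ => ?_⟩⟩
  · -- the E-clause: equality at the top level, `0 ≤ …` below it
    have hnn : 0 ≤ ∑ n ∈ Icc j k', (Lb ^ ((j : ℝ) - n)) ^ β * (if n = k then (1 : ℝ) else 0) :=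
      sum_nonneg fun n _ => mul_nonneg (Real.rpow_nonneg (Real.rpow_nonneg hL0.le _) _) (by split_ifs <;> norm_num)
    dsimp only
    split_ifs with hk
    · subst hk
      rw [one_mul, abs_of_nonneg (pow_nonneg (Real.rpow_nonneg hL0.le _) _),
        sum_eq_single_of_mem k' (mem_Icc.mpr ⟨hjk, le_rfl⟩) (fun n _ hn => by rw [if_neg hn, mul_zero]),
        if_pos rfl, mul_one, N19SizeWindow.rpow_sub_rpow_eq_pow hL0 hjk]
    · rw [abs_zero, one_mul]; exact hnn
  · dsimp only
    rw [abs_zero, zero_mul, zero_mul]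

/-- **THE FACE FIRES ON THE TOY, NON-DEGENERATELY** [decided toy]: with the toy printed family (`1 < L`, `0 < β < 1`), N14's
pinned pair on `toyTower` (`Λ = Λ₀ = 2`, `N₀ = 1`), the two-domain ledger of scale `0` at every cutoff `K` (vacuum entry of run A
`(L^{−β})^K`, dressed entry of run A = the toy's booked size, run B `≡ 0`), `vol = G = 1`, `Cl = 0`, `K₁ = 1`: EVERY displayed
binder of `sizePair_of_n11_n14` is met ((v-A)∕(v-B): member `K+1`, level `j+1`; (d): birth map to the one birth, the one top
cube), and the face yields constants `E₀ ≥ 0`, `0 < a < 1`, `m` with, at every cutoff,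
`0 < (L^{−β})^K + size ≤ 1·(E₀·(K+1)^m·a^K)` — the slice-`0` discrepancy is NONZERO and inside the profile. [folklore] -/
theorem sizePair_toy {Lb β : ℝ} (hLb : 1 < Lb) (hβ0 : 0 < β) (hβ1 : β < 1) :
    ∃ (E₀ a : ℝ) (m : ℕ), 0 ≤ E₀ ∧ 0 < a ∧ a < 1 ∧ ∀ K : ℕ,
      0 < (Lb ^ (-β)) ^ K + (toyBooking K).size () K ∧
        (Lb ^ (-β)) ^ K + (toyBooking K).size () K ≤ 1 * (E₀ * ((K : ℝ) + 1) ^ m * a ^ (K - 0)) := by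
  have hL0 : 0 < Lb := one_pos.trans hLb
  have ha₁ : 0 < Lb ^ (-β) := Real.rpow_pos_of_pos hL0 _
  have key := sizePair_of_n11_n14 (J := ℕ) (D := Bool) (fun _ => True)
    (fun _ => (univ : Finset Bool)) (fun _ => 0)
    (fun K X => if X = true then (toyBooking K).size () K else (Lb ^ (-β)) ^ K) (fun _ _ => 0) (fun K => K)
    (fun X => X = true) (fun _ _ => True) _ (thm2Printed_toyFam (β := β) hLb) hβ1 hβ0 hLb
    (vol := 1) (G := 1) (Cl := 0) zero_le_one le_rfl le_rfl 1
    (𝒯 := toyTower) (Λ := 2) (Λ₀ := 2) (N₀ := 1)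
    ⟨YMDAG.N14.n14_toyTower_pinned.1, YMDAG.N14.n14_toyTower_pinned.2.1⟩ zero_le_one (by norm_num) le_rfl
    ?vA ?vB ?d
  case vA =>
    intro K _ j hj
    refine ⟨K + 1, (), j + 1, fun k _ => by norm_num, trivial, Nat.le_add_left 1 j, Nat.add_le_add_right hj 1,
      Nat.add_sub_add_right K 1 j, le_rfl, fun n => by dsimp only; split_ifs <;> norm_num,
      by dsimp only; rw [if_pos rfl], fun n hn _ => by dsimp only; rw [if_neg hn.ne],
      fun n hn _ => by dsimp only; rw [if_neg hn.ne]; positivity, ?_⟩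
    dsimp only
    rw [if_pos rfl, Nat.add_sub_add_right K 1 j, abs_of_nonneg (pow_nonneg ha₁.le _)]
    by_cases hj0 : j = 0
    · subst hj0
      have hfl : ((univ : Finset Bool).filter fun X => ¬ X = true).filter (fun _ => (0 : ℕ) = 0) = {false} := by
        ext b; cases b <;> simp
      rw [hfl, sum_singleton, if_neg Bool.false_ne_true, abs_of_nonneg (pow_nonneg ha₁.le _), Nat.sub_zero]
    · have hfl : ((univ : Finset Bool).filter fun X => ¬ X = true).filter (fun _ => (0 : ℕ) = j) = ∅ :=
        filter_false_of_mem fun _ _ => fun h => hj0 h.symm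
      rw [hfl, sum_empty, abs_zero]; positivity
  case vB =>
    intro K _ j hj
    refine ⟨K + 1, (), j + 1, fun k _ => by norm_num, trivial, Nat.le_add_left 1 j, Nat.add_le_add_right hj 1,
      Nat.add_sub_add_right K 1 j, le_rfl, fun n => by dsimp only; split_ifs <;> norm_num,
      by dsimp only; rw [if_pos rfl], fun n hn _ => by dsimp only; rw [if_neg hn.ne],
      fun n hn _ => by dsimp only; rw [if_neg hn.ne]; positivity, ?_⟩
    rw [sum_const_zero, abs_zero]; exact abs_nonneg _
  case d =>
    intro K _
    refine ⟨(), fun _ => (), {⟨K, Nat.lt_succ_self K⟩}, (), K, fun _ => (), fun _ _ => rfl, ?_, fun c hc => ?_,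
      by simp, fun _ _ => ⟨⟨K, Nat.lt_succ_self K⟩, mem_singleton_self _, mem_singleton_self _⟩, fun _ _ => rfl,
      fun X hX => ?_, fun X _ => ?_⟩
    · intro j b₁ h₁ b₂ h₂ _
      have e₁ : b₁ = true := (mem_filter.mp (mem_filter.mp (Finset.mem_coe.mp h₁)).1).2
      have e₂ : b₂ = true := (mem_filter.mp (mem_filter.mp (Finset.mem_coe.mp h₂)).1).2
      rw [e₁, e₂]
    · rw [mem_singleton] at hc; subst hc; rfl
    · have hXt : X = true := (mem_filter.mp hX).2
      subst hXt
      rw [if_pos rfl, abs_of_nonneg ((toyBooking K).size_nonneg () K)]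
      exact le_rfl
    · rw [abs_zero]; exact (toyBooking K).size_nonneg () K
  obtain ⟨E₀, a, m, hE₀, ha0, ha1, hface⟩ := key
  refine ⟨E₀, a, m, hE₀, ha0, ha1, fun K => ⟨add_pos (pow_pos ha₁ K) (toy_size_pos K K ()), ?_⟩⟩
  have h := hface K trivial 0 (Nat.zero_le K)
  have hs : ∑ X ∈ (univ : Finset Bool) with (0 : ℕ) = 0,
      ((0 : ℝ) - (if X = true then (toyBooking K).size () K else (Lb ^ (-β)) ^ K))
      = -((Lb ^ (-β)) ^ K + (toyBooking K).size () K) := by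
    rw [filter_true_of_mem fun _ _ => rfl, Fintype.sum_bool, if_pos rfl, if_neg Bool.false_ne_true]; ring
  rw [hs, abs_neg, abs_of_pos (add_pos (pow_pos ha₁ K) (toy_size_pos K K ()))] at h
  exact h

end Summit.QuantumFields.YangMills.BalabanUVNodes.N19SizeByName

end
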